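import Mathlib
import HarnessLib
import Summits.NavierStokesRegularity.NavierStokesRegularity.Theorems.PoloidalWindowDoorPoloidalWindowRigidityClebsch
import Summits.NavierStokesRegularity.NavierStokesRegularity.Theorems.PoloidalWindowDoorPoloidalWindowRigidityConstantShearMeans

/-!
# Route `PoloidalWindowDoor`, item `LrcModEntire` (stmt-NavierStokesRegularity-20428) / crux K2 (stmt-19708) —
# A SYMMETRY GERM OF THE STREAM FUNCTION IS A SYMMETRY GERM OF THE VORTICITY (the last step of the structural transfer)

Cell ns-regularity-ideate, seat ns-poloidal-K2-p3 gen 5 (LEAD of item 20428, skeleton `slope-split`; file landed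
`--supports stmt-NavierStokesRegularity-20428` as a helper).

The structural route to the thick-stratum stub `stub_lrcGeneric` (shared by 20428 and the K2 lead's v4 skeleton of 19708) ends,
by the K2 lead's ISOPARAMETRIC DETECTOR (ns-poloidal-K2-p1 g5, STRUCT-NOTES-g5 v2 §5, 2026-08-27T13:19Z: at the collapse order the
jet system forces the vortex lines of each horizontal plane to be concentric circles about a common vertical axis, or parallel
lines), in a statement about the Clebsch STREAM FUNCTION `ψ` of a slice (`curl v(s) = ∇ψ × e₂`, tree `…Clebsch.exists_clebsch_slice`):
on an open set, `ψ` is invariant under the rotations about a vertical axis `c + ℝe₂` (infinitesimally: `Dψ(y)[J(y − c)] = 0`) or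
under the translations along a horizontal direction `e` (`Dψ(y)[e] = 0`).  The registered stubs, however, conclude a symmetry germ
of the VORTICITY: `J ω(y) = Dω(y)[J(y − c)]`, resp. `Dω(y)[e] = 0`.  This file is that last, purely differential step:

* `fderiv_streamVorticity_apply` — bookkeeping: for `ω = (∂₁ψ, −∂₀ψ, 0)` with `ψ ∈ C²`, `(Dω(y) w)ᵢ` in terms of the
  second derivatives of `ψ`;
* `vorticity_translation_germ_of_stream` — **`Dψ(y)[e] = 0` on an open `U` ⇒ `Dω(y)[e] = 0` on `U`** (differentiate the
  identity along `U`; symmetry of second derivatives);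
* `vorticity_rotation_germ_of_stream` — **`Dψ(y)[J(y − c)] = 0` on an open `U` ⇒ `J ω(y) = Dω(y)[J(y − c)]` on `U`**
  (differentiate `y ↦ Dψ(y)[J(y − c)]` along `U`: `D²ψ(y)(w, J(y−c)) = −Dψ(y)(Jw)`, then `J e₁ = −e₀`, `J e₀ = e₁`);
* `lrcGerm_of_stream_germ` — CLASS packaging: for a profile of the route's Type-I class, poloidal along `e₃`, a slice `s < 0`
  with its Clebsch stream function `ψ` (tree), a rotation OR translation germ of `ψ` on a nonempty open `U` yields VERBATIM the
  first two legs of the germ trichotomy of `LrcModEntire` / `stub_lrcGeneric` / `stub_timeHeightShearGerm` on `(s, U)`.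

WHAT THIS IS NOT: not a claim about Navier–Stokes regularity, not the isoparametric lemma (Levi-Civita–Segre, the K2 lead's
announced Lean target) and not the stub — the transfer from stream-function symmetry to vorticity symmetry (bears_on LADDER-NS N0
via items 20428 / 19708).
-/

noncomputable section

-- the summit and its single sub-problem share the name (CONVENTIONS §1), as in every Theorems file
set_option linter.dupNamespace false

namespace Summit.NavierStokesRegularity.NavierStokesRegularity.Theorems.PoloidalWindowDoorLrcModEntireStreamSymmetryGerm

open Set Function Filter Topology Metric
open scoped RealInnerProductSpace InnerProductSpace
open Literature.Analysis Literature.Analysis.FluidPDE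
open Summit.NavierStokesRegularity.NavierStokesRegularity.Theorems.PoloidalWindowDoorPoloidalWindowRigidityClebsch
open Summit.NavierStokesRegularity.NavierStokesRegularity.Theorems.PoloidalWindowDoorPoloidalWindowRigidityConstantShearMeans

/-! ### Generic: a `C²` stream function and its vorticity `ω = (∂₁ψ, −∂₀ψ, 0)` -/

section Generic

variable {ψ : EuclideanSpace ℝ (Fin 3) → ℝ} {ω : EuclideanSpace ℝ (Fin 3) → EuclideanSpace ℝ (Fin 3)}

/-- The partial-derivative functions `y ↦ Dψ(y) a` of a `C²` function are differentiable, with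
`D(y ↦ Dψ(y) a)(y) b = D(y ↦ Dψ(y) b)(y) a` (symmetry of second derivatives; tree `fderiv_fderiv_symm`). -/
theorem differentiableAt_fderiv_apply (hψ : ContDiff ℝ 2 ψ) (a y : EuclideanSpace ℝ (Fin 3)) :
    DifferentiableAt ℝ (fun y' => fderiv ℝ ψ y' a) y :=
  (((hψ.fderiv_right (m := 1) (by norm_num)).clm_apply contDiff_const).differentiable one_ne_zero) y

/-- **Coordinates of `Dω(y) w` for `ω = (∂₁ψ, −∂₀ψ, 0)`**: `(Dω(y) w)₀ = D(∂₁ψ)(y) w`, `(Dω(y) w)₁ = −D(∂₀ψ)(y) w`,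
`(Dω(y) w)₂ = 0`. -/
theorem fderiv_streamVorticity_apply (hψ : ContDiff ℝ 2 ψ)
    (hω : ∀ y, ω y 0 = fderiv ℝ ψ y (EuclideanSpace.single 1 1) ∧
      ω y 1 = -fderiv ℝ ψ y (EuclideanSpace.single 0 1) ∧ ω y 2 = 0)
    (y w : EuclideanSpace ℝ (Fin 3)) :
    fderiv ℝ ω y w 0 = fderiv ℝ (fun y' => fderiv ℝ ψ y' (EuclideanSpace.single 1 1)) y w ∧
      fderiv ℝ ω y w 1 = -fderiv ℝ (fun y' => fderiv ℝ ψ y' (EuclideanSpace.single 0 1)) y w ∧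
      fderiv ℝ ω y w 2 = 0 := by
  -- `ω` is differentiable: its coordinates are
  have h0f : (fun y' => ω y' 0) = fun y' => fderiv ℝ ψ y' (EuclideanSpace.single 1 1) := funext fun y' => (hω y').1
  have h1f : (fun y' => ω y' 1) = fun y' => -fderiv ℝ ψ y' (EuclideanSpace.single 0 1) :=
    funext fun y' => (hω y').2.1
  have h2f : (fun y' => ω y' 2) = fun _ => (0 : ℝ) := funext fun y' => (hω y').2.2
  have hd0 : DifferentiableAt ℝ (fun y' => ω y' 0) y := by
    rw [h0f]; exact differentiableAt_fderiv_apply hψ _ y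
  have hd1 : DifferentiableAt ℝ (fun y' => ω y' 1) y := by
    rw [h1f]; exact (differentiableAt_fderiv_apply hψ _ y).neg
  have hd2 : DifferentiableAt ℝ (fun y' => ω y' 2) y := by
    rw [h2f]; exact differentiableAt_const _
  have hdω : DifferentiableAt ℝ ω y := by
    rw [differentiableAt_piLp]
    intro i
    fin_cases i
    · exact hd0
    · exact hd1
    · exact hd2
  refine ⟨?_, ?_, ?_⟩
  · rw [← fderiv_coord_apply hdω 0 w, h0f]
  · rw [← fderiv_coord_apply hdω 1 w, h1f, fderiv_fun_neg, neg_apply]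
  · rw [← fderiv_coord_apply hdω 2 w, h2f, fderiv_fun_const]
    rfl

/-- **A translation germ of the stream function is a translation germ of the vorticity.**  If `ψ ∈ C²`,
`ω = (∂₁ψ, −∂₀ψ, 0)`, and `Dψ(y)[e] = 0` for all `y` in an open set `U`, then `Dω(y)[e] = 0` for all `y ∈ U`. -/
theorem vorticity_translation_germ_of_stream (hψ : ContDiff ℝ 2 ψ)
    (hω : ∀ y, ω y 0 = fderiv ℝ ψ y (EuclideanSpace.single 1 1) ∧
      ω y 1 = -fderiv ℝ ψ y (EuclideanSpace.single 0 1) ∧ ω y 2 = 0)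
    {U : Set (EuclideanSpace ℝ (Fin 3))} (hU : IsOpen U) {e : EuclideanSpace ℝ (Fin 3)}
    (h : ∀ y ∈ U, fderiv ℝ ψ y e = 0) {y : EuclideanSpace ℝ (Fin 3)} (hy : y ∈ U) :
    fderiv ℝ ω y e = 0 := by
  -- `y ↦ Dψ(y) e` vanishes on the open `U`, hence so does its derivative there
  have hzero : fderiv ℝ (fun y' => fderiv ℝ ψ y' e) y = 0 := by
    have hev : (fun y' => fderiv ℝ ψ y' e) =ᶠ[𝓝 y] fun _ => (0 : ℝ) :=
      Filter.eventually_of_mem (hU.mem_nhds hy) fun y' hy' => h y' hy'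
    rw [hev.fderiv_eq, fderiv_fun_const]
    rfl
  obtain ⟨h0, h1, h2⟩ := fderiv_streamVorticity_apply hψ hω y e
  ext i
  fin_cases i
  · show fderiv ℝ ω y e 0 = 0
    rw [h0, fderiv_fderiv_symm hψ, hzero]; rfl
  · show fderiv ℝ ω y e 1 = 0
    rw [h1, fderiv_fderiv_symm hψ, hzero]; simp
  · show fderiv ℝ ω y e 2 = 0
    exact h2

/-- **A rotation germ of the stream function is a rotation germ of the vorticity.**  If `ψ ∈ C²`,
`ω = (∂₁ψ, −∂₀ψ, 0)`, and `Dψ(y)[J(y − c)] = 0` for all `y` in an open set `U` (`J = rotGen`, the generator of the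
rotations about the vertical axis through `c`), then `J ω(y) = Dω(y)[J(y − c)]` for all `y ∈ U`. -/
theorem vorticity_rotation_germ_of_stream (hψ : ContDiff ℝ 2 ψ)
    (hω : ∀ y, ω y 0 = fderiv ℝ ψ y (EuclideanSpace.single 1 1) ∧
      ω y 1 = -fderiv ℝ ψ y (EuclideanSpace.single 0 1) ∧ ω y 2 = 0)
    {U : Set (EuclideanSpace ℝ (Fin 3))} (hU : IsOpen U) (c : EuclideanSpace ℝ (Fin 3))
    (h : ∀ y ∈ U, fderiv ℝ ψ y (rotGen (y - c)) = 0) {y : EuclideanSpace ℝ (Fin 3)} (hy : y ∈ U) :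
    rotGen (ω y) = fderiv ℝ ω y (rotGen (y - c)) := by
  -- abbreviations
  have hD : DifferentiableAt ℝ (fderiv ℝ ψ) y :=
    ((hψ.fderiv_right (m := 1) (by norm_num)).differentiable one_ne_zero) y
  have hK : HasFDerivAt (fun y' : EuclideanSpace ℝ (Fin 3) => rotGen (y' - c)) rotGenL y := by
    have h1 : HasFDerivAt (fun y' : EuclideanSpace ℝ (Fin 3) => y' - c) (ContinuousLinearMap.id ℝ _) y :=
      (hasFDerivAt_id y).sub_const c
    have h2 : HasFDerivAt (⇑rotGenL ∘ fun y' : EuclideanSpace ℝ (Fin 3) => y' - c)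
        (rotGenL.comp (ContinuousLinearMap.id ℝ _)) y := rotGenL.hasFDerivAt.comp y h1
    rw [ContinuousLinearMap.comp_id] at h2
    exact h2
  -- differentiate `g(y) = Dψ(y)[J(y−c)] = 0` on `U`: `D²ψ(y)(w)(J(y−c)) + Dψ(y)(J w) = 0`
  have hg : HasFDerivAt (fun y' => fderiv ℝ ψ y' (rotGen (y' - c)))
      ((fderiv ℝ ψ y).comp rotGenL + (fderiv ℝ (fderiv ℝ ψ) y).flip (rotGen (y - c))) y :=
    hD.hasFDerivAt.clm_apply hK
  have hzero : fderiv ℝ (fun y' => fderiv ℝ ψ y' (rotGen (y' - c))) y = 0 := by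
    have hev : (fun y' => fderiv ℝ ψ y' (rotGen (y' - c))) =ᶠ[𝓝 y] fun _ => (0 : ℝ) :=
      Filter.eventually_of_mem (hU.mem_nhds hy) fun y' hy' => h y' hy'
    rw [hev.fderiv_eq, fderiv_fun_const]
    rfl
  have hid : ∀ w : EuclideanSpace ℝ (Fin 3),
      fderiv ℝ (fderiv ℝ ψ) y w (rotGen (y - c)) = -fderiv ℝ ψ y (rotGen w) := by
    intro w
    have h1 := congrArg (fun L : EuclideanSpace ℝ (Fin 3) →L[ℝ] ℝ => L w) hg.fderiv
    simp only [hzero, zero_apply, add_apply, ContinuousLinearMap.flip_apply,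
      ContinuousLinearMap.comp_apply, rotGenL_apply] at h1
    linarith
  have hsymm : ∀ a b : EuclideanSpace ℝ (Fin 3),
      fderiv ℝ (fderiv ℝ ψ) y a b = fderiv ℝ (fderiv ℝ ψ) y b a := fun a b =>
    hψ.contDiffAt.isSymmSndFDerivAt (by simp) a b
  -- second derivatives of `ψ` in coordinates: `D(∂_a ψ)(y) w = D²ψ(y)(w)(a)`
  have hsec : ∀ a w : EuclideanSpace ℝ (Fin 3),
      fderiv ℝ (fun y' => fderiv ℝ ψ y' a) y w = fderiv ℝ (fderiv ℝ ψ) y w a := by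
    intro a w
    rw [fderiv_clm_apply hD (differentiableAt_const a)]
    simp
  obtain ⟨h0, h1, h2⟩ := fderiv_streamVorticity_apply hψ hω y (rotGen (y - c))
  have hJ1 : rotGen (EuclideanSpace.single 1 (1 : ℝ) : EuclideanSpace ℝ (Fin 3)) = -EuclideanSpace.single 0 1 := by
    ext i; fin_cases i <;> simp [rotGen]
  have hJ0 : rotGen (EuclideanSpace.single 0 (1 : ℝ) : EuclideanSpace ℝ (Fin 3)) = EuclideanSpace.single 1 1 := by
    ext i; fin_cases i <;> simp [rotGen]
  ext i
  fin_cases i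
  · -- component 0: `(Jω)₀ = −ω₁ = ∂₀ψ`; `(Dω[K])₀ = D(∂₁ψ)[K] = D²ψ(K)(e₁) = D²ψ(e₁)(K) = −Dψ(J e₁) = ∂₀ψ`
    show rotGen (ω y) 0 = fderiv ℝ ω y (rotGen (y - c)) 0
    rw [rotGen_apply_zero, (hω y).2.1, h0, hsec, hsymm, hid, hJ1, map_neg]
  · show rotGen (ω y) 1 = fderiv ℝ ω y (rotGen (y - c)) 1
    rw [rotGen_apply_one, (hω y).1, h1, hsec, hsymm, hid, hJ0]
    ring
  · show rotGen (ω y) 2 = fderiv ℝ ω y (rotGen (y - c)) 2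
    rw [rotGen_apply_two, h2]

end Generic

/-! ### Packaging in the currency of the registered stubs -/

/-- **From a symmetry germ of the stream function to the germ trichotomy of `LrcModEntire` / `stub_lrcGeneric` /
`stub_timeHeightShearGerm`.**  Let `s < 0` and let `ψ ∈ C²` carry the vorticity of the slice `v s` as
`curl (v s) = (∂₁ψ, −∂₀ψ, 0)` (e.g. the Clebsch stream function of the tree's `…Clebsch.exists_clebsch_slice`).  If on a
nonempty open `U` the stream function has a translation germ along some `e ≠ 0` (`Dψ(y)[e] = 0`) or a rotation germ about
the vertical axis through some `c` (`Dψ(y)[J(y − c)] = 0`), then `(s, U)` witnesses the conclusion of the registered stubs: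
a translation germ or a vertical-axis rotation germ of the VORTICITY (the third, entire-field leg is not needed). -/
theorem lrcGerm_of_stream_germ {v : ℝ → EuclideanSpace ℝ (Fin 3) → EuclideanSpace ℝ (Fin 3)} {s : ℝ} (hs : s < 0)
    {ψ : EuclideanSpace ℝ (Fin 3) → ℝ} (hψ : ContDiff ℝ 2 ψ)
    (hω : ∀ y, curl (v s) y 0 = fderiv ℝ ψ y (EuclideanSpace.single 1 1) ∧
      curl (v s) y 1 = -fderiv ℝ ψ y (EuclideanSpace.single 0 1) ∧ curl (v s) y 2 = 0)
    {U : Set (EuclideanSpace ℝ (Fin 3))} (hU : IsOpen U) (hUne : U.Nonempty)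
    (hgerm : (∃ e : EuclideanSpace ℝ (Fin 3), e ≠ 0 ∧ ∀ y ∈ U, fderiv ℝ ψ y e = 0) ∨
      (∃ c : EuclideanSpace ℝ (Fin 3), ∀ y ∈ U, fderiv ℝ ψ y (rotGen (y - c)) = 0)) :
    ∃ s' : ℝ, s' < 0 ∧ ∃ U' : Set (EuclideanSpace ℝ (Fin 3)), IsOpen U' ∧ U'.Nonempty ∧
      ((∃ e : EuclideanSpace ℝ (Fin 3), e ≠ 0 ∧ ∀ y ∈ U', fderiv ℝ (curl (v s')) y e = 0) ∨
       (∃ c : EuclideanSpace ℝ (Fin 3), ∀ y ∈ U',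
          rotGen (curl (v s') y) = fderiv ℝ (curl (v s')) y (rotGen (y - c))) ∨
       (∃ w : EuclideanSpace ℝ (Fin 3) → EuclideanSpace ℝ (Fin 3), AnalyticOnNhd ℝ w univ ∧
          ¬ BddAbove (Set.range fun y => ‖w y‖) ∧ ∀ y ∈ U', v s' y = w y)) := by
  rcases hgerm with ⟨e, he, htr⟩ | ⟨c, hrot⟩
  · exact ⟨s, hs, U, hU, hUne, Or.inl ⟨e, he, fun y hy =>
      vorticity_translation_germ_of_stream hψ hω hU htr hy⟩⟩
  · exact ⟨s, hs, U, hU, hUne, Or.inr (Or.inl ⟨c, fun y hy =>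
      vorticity_rotation_germ_of_stream hψ hω hU c hrot hy⟩)⟩


end Summit.NavierStokesRegularity.NavierStokesRegularity.Theorems.PoloidalWindowDoorLrcModEntireStreamSymmetryGerm

end
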